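import Literature.Topology.FourManifolds.FramedLinkTraceExistence
import Literature.Topology.FourManifolds.FramedLinkTraceBoundary
import Literature.Topology.FourManifolds.RLinkSphere
import Literature.Topology.FourManifolds.OneHandleBoundaryStepProofs
import Literature.Topology.FourManifolds.LinkSurgeryFramedUniqueness
import Literature.Topology.FourManifolds.GluingProofs
import Literature.Topology.FourManifolds.RLinkSphereHomotopySphereProofs
import HarnessLib

/-!
# Every R-link has a closed `4`-manifold `Σ_L` (Gompf–Scharlemann–Thompson 2010, §9)

Topic `Literature/Topology/FourManifolds`; roadmap item 4 of `RLinkSphere.lean` ("Existence of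
`Σ_L` for an R-link"), assembled from the pieces landed on 2026-08-17 for the line `sphere_split`
of the SPC4 crux `VerlindeRLinks.VrlSliceRigidity` (stmt-SmoothPoincare4-16179):

* `FramedLink.exists_isTrace` (`FramedLinkTraceExistence.lean`) — every framed link has a compact
  trace `X_L = B⁴ ∪_L (2-handles)` (Kirby 1989, Ch. I §2, p. 8);
* `FramedLink.IsTrace.isSurgery_boundary` (`FramedLinkTraceBoundary.lean`) — the boundary of a
  trace of `L` is the integral surgery on `L` (Kirby 1989, Ch. I Lemma 2.1 / §5);
* `exists_oneHandlebody_four_boundary_isSphereTwoProdCircleSum_holds`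
  (`OneHandleBoundaryStepProofs.lean`) — for every `n` some compact connected orientable
  `(1,n)`-handlebody has boundary `#ⁿ(S² × S¹)` (Kirby 1989, Ch. I §2, p. 8: "`♮ᵏ S¹ × B³` … with
  boundary `#ᵏ S¹ × S²`");

together with the uniqueness of surgery (`FramedLink.IsSurgery.nonempty_diffeomorph_holds`), the
fact that `IsSphereTwoProdCircleSum n` has one diffeomorphism type
(`IsSphereTwoProdCircleSum.nonempty_diffeomorph`, `.of_diffeomorph`), existence of boundary data
(`nonempty_boundaryData_holds`) and of gluings along the boundary (`exists_isBoundaryGluing_holds`).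

R. E. Gompf, M. Scharlemann, A. Thompson, Geom. Topol. 14 (2010) 2305–2347 (arXiv:1103.1601),
§9 p. 19: *"Suppose `L` is an `n`-component link on which surgery gives `#_n(S¹ × S²)`. …
Consider the closed `4`-manifold `W` obtained by attaching `2`-handles to `D⁴` via the framed link
`L`, then attaching `♮_n(S¹ × B³)` to the resulting manifold along their common boundary
`#_n(S¹ × S²)`."*  In the tree's vocabulary (`IsRLinkSphere X L`, `RLinkSphere.lean`): if
`Y ≅ #ⁿ(S² × S¹)` (`IsSphereTwoProdCircleSum n Y`) is integral surgery on the `n`-component framed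
link `L` (`L.IsSurgery (𝓡 3) Y`), then some Hausdorff second-countable smooth closed `4`-manifold
`X : Type` satisfies `IsRLinkSphere X L`.  Everything is proved; no definition, no named fact.
Consumers: the composition of the line `sphere_split` (its `sphereExists_of_stubs` is this theorem),
the route items `VrlComponentsHBallSlice` (GST Prop. 2.3) and the typing of `VrlSkeinBlindOnSphere`,
and, with `IsRLinkSphere.nonempty_homotopyEquiv_sphere_holds`, "every R-link yields a homotopy
`4`-sphere" (`exists_homotopySphere_of_rLink` below).

## References

* R. E. Gompf, M. Scharlemann, A. Thompson, Geom. Topol. 14 (2010) 2305–2347, §9 (arXiv p. 19)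
  and proof of Prop. 9.2. [GompfScharlemannThompson2010]
* R. C. Kirby, *The Topology of 4-Manifolds*, LNM 1374 (1989), Ch. I §2 (p. 8), Lemma 2.1, §5.
  [Kirby1989]
* F. Laudenbach, V. Poénaru, Bull. Soc. Math. France 100 (1972) 337–344 (uniqueness, not used
  here). [LaudenbachPoenaruBSMF1972]
-/

open scoped Manifold ContDiff Topology
open Set Function

noncomputable section

namespace Literature.Topology.FourManifolds

/-- **Every R-link has a closed manifold `Σ_L`** (Gompf–Scharlemann–Thompson 2010, §9: "Consider
the closed `4`-manifold `W` obtained by attaching `2`-handles to `D⁴` via the framed link `L`, then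
attaching `♮_n(S¹ × B³)` to the resulting manifold along their common boundary `#_n(S¹ × S²)`"):
if `Y ≅ #ⁿ(S² × S¹)` is integral surgery on the `n`-component framed link `L`, then there is a
Hausdorff second countable smooth closed `4`-manifold `X` with `IsRLinkSphere X L`.  Proof: a
compact trace `P` of `L` exists (`FramedLink.exists_isTrace`); a boundary datum `bP` exists
(`nonempty_boundaryData_holds`); its carrier is surgery on `L`
(`FramedLink.IsTrace.isSurgery_boundary`), hence diffeomorphic to `Y` (uniqueness of surgery,
`FramedLink.IsSurgery.nonempty_diffeomorph_holds`), hence `#ⁿ(S² × S¹)`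
(`IsSphereTwoProdCircleSum.of_diffeomorph`); some compact connected orientable `(1,n)`-handlebody
`V` has boundary `#ⁿ(S² × S¹)` (`exists_oneHandlebody_four_boundary_isSphereTwoProdCircleSum_holds`),
so `∂P ≅ ∂V` (`IsSphereTwoProdCircleSum.nonempty_diffeomorph`), and the gluing `X = P ∪_φ V`
exists (`exists_isBoundaryGluing_holds`) and is an `IsRLinkSphere X L` (`IsRLinkSphere.mk`).
[cite: GompfScharlemannThompson2010, §9 (arXiv p. 19)] -/
theorem exists_isRLinkSphere {n : ℕ} (L : FramedLink (Fin n)) (Y : Type) [TopologicalSpace Y]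
    [T2Space Y] [SecondCountableTopology Y] [ChartedSpace (EuclideanSpace ℝ (Fin 3)) Y]
    [IsManifold (𝓡 3) ∞ Y] (hY : IsSphereTwoProdCircleSum n Y) (hL : L.IsSurgery (𝓡 3) Y) :
    ∃ (X : Type) (_ : TopologicalSpace X) (_ : T2Space X) (_ : SecondCountableTopology X)
      (_ : ChartedSpace (EuclideanSpace ℝ (Fin 4)) X) (_ : IsManifold (𝓡 4) ∞ X),
      IsRLinkSphere X L := by
  -- a compact trace `P` of `L`
  obtain ⟨P, _, _, _, _, _, _, hP⟩ := FramedLink.exists_isTrace L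
  -- a boundary datum of `P` (the boundary is a smooth closed `3`-manifold)
  obtain ⟨bP⟩ := nonempty_boundaryData_holds 3 P
  haveI : T2Space bP.carrier := bP.t2Space_carrier
  haveI : SecondCountableTopology bP.carrier := bP.secondCountableTopology_carrier
  -- `∂P` is surgery on `L`, hence `≅ Y ≅ #ⁿ(S² × S¹)`
  have hbP : L.IsSurgery (𝓡 3) bP.carrier := hP.isSurgery_boundary bP
  obtain ⟨eY⟩ := FramedLink.IsSurgery.nonempty_diffeomorph_holds hL hbP
  have hsumP : IsSphereTwoProdCircleSum n bP.carrier := hY.of_diffeomorph eY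
  -- a `(1,n)`-handlebody `V` with `∂V ≅ #ⁿ(S² × S¹)`
  obtain ⟨V, _, _, _, _, _, _, _, bV, hV, hoV, hsumV⟩ :=
    exists_oneHandlebody_four_boundary_isSphereTwoProdCircleSum_holds n
  haveI : T2Space bV.carrier := bV.t2Space_carrier
  -- `∂P ≅ ∂V`: `IsSphereTwoProdCircleSum n` has one diffeomorphism type
  obtain ⟨φ⟩ := IsSphereTwoProdCircleSum.nonempty_diffeomorph n bP.carrier bV.carrier hsumP hsumV
  -- glue: `X = P ∪_φ V`
  obtain ⟨X, _, _, _, _, _, _, hX⟩ := exists_isBoundaryGluing_holds bP bV φ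
  exact ⟨X, _, ‹_›, ‹_›, _, ‹_›, IsRLinkSphere.mk hP hV hoV hX⟩

/-- **Every R-link yields a homotopy `4`-sphere** (Gompf–Scharlemann–Thompson 2010, §9: "The
result is a simply-connected … homology `4`-sphere, hence a homotopy `4`-sphere"; proof of
Prop. 9.2): if `Y ≅ #ⁿ(S² × S¹)` is integral surgery on `L`, then some compact smooth `X` with
`IsRLinkSphere X L` is homotopy equivalent to `S⁴` — existence (`exists_isRLinkSphere`) composed
with the tree's discharged fact `IsRLinkSphere.nonempty_homotopyEquiv_sphere_holds` and
`IsRLinkSphere.compactSpace`. [cite: GompfScharlemannThompson2010, §9 and proof of Prop. 9.2] -/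
theorem exists_homotopySphere_of_rLink {n : ℕ} (L : FramedLink (Fin n)) (Y : Type)
    [TopologicalSpace Y] [T2Space Y] [SecondCountableTopology Y]
    [ChartedSpace (EuclideanSpace ℝ (Fin 3)) Y] [IsManifold (𝓡 3) ∞ Y]
    (hY : IsSphereTwoProdCircleSum n Y) (hL : L.IsSurgery (𝓡 3) Y) :
    ∃ (X : Type) (_ : TopologicalSpace X) (_ : T2Space X) (_ : SecondCountableTopology X)
      (_ : ChartedSpace (EuclideanSpace ℝ (Fin 4)) X) (_ : IsManifold (𝓡 4) ∞ X)
      (_ : CompactSpace X), IsRLinkSphere X L ∧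
        Nonempty (ContinuousMap.HomotopyEquiv X (Metric.sphere (0 : EuclideanSpace ℝ (Fin 5)) 1)) := by
  obtain ⟨X, _, _, _, _, _, hX⟩ := exists_isRLinkSphere L Y hY hL
  haveI : CompactSpace X := hX.compactSpace
  exact ⟨X, _, ‹_›, ‹_›, _, ‹_›, ‹_›, hX,
    IsRLinkSphere.nonempty_homotopyEquiv_sphere_holds n L X hX⟩

end Literature.Topology.FourManifolds

end
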